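import Literature.IUT.HodgeTheaters.TemperedCoveringsCor23viOfSpecialFibre
import HarnessLib

/-!
# [IUTchI] Cor. 2.3 (vi) at the genuine 𝔛-datum: the profinite LAW `hhatH` REDUCED to ONE general
# pro-`Σ̂` edge–subgraph incidence statement plus the cusp ↦ open-edge dictionary (row «COR23VI-HATH-PROSIGMA»)

S. Mochizuki, *Inter-universal Teichmüller theory I: construction of Hodge theaters*, kurims manuscript (May 2020),
§2, Corollary 2.3 (vi) p. 48 l. 6–16, proof p. 49 l. 62–64 ("Assertion (vi) follows immediately from a similar
argument to the argument applied in the proof of [CombGC], Proposition 1.5, (i), by passing to pro-`Σ` completions")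
[cite: Mochizuki2012, Cor 2.3(vi) pp.48-49] (D-0012 claim key; series status DISPUTED; nothing of the series is
asserted here — PROVED below are implications between statements about the tree's own objects);
Y. Hoshi, S. Mochizuki, *On the combinatorial anabelian geometry of nodally nondegenerate outer representations*,
Hiroshima Math. J. **41** (2011), Lemma 1.7 p. 17 ("`ẽ ∈ ℰ(ṽ)` if and only if `Π_ṽ ∩ Π_ẽ ≠ {1}`")
[cite: HoshiMochizukiNodNon2011, Lem 1.7 p.17]; Y. Hoshi, S. Mochizuki, *Topics surrounding the combinatorial
anabelian geometry of hyperbolic curves I*, Adv. Stud. Pure Math. **63** (2012), Def. 2.8 / Prop. 2.9 (i) p. 44 (the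
generization `𝒢⇝S` and its specialization outer isomorphism `Φ_{𝒢⇝S} : Π_{𝒢⇝S} ⥲ Π_𝒢`, carrying the verticial
subgroup `Π_{v_ℍ}` onto the image of `Π_{𝒢|_ℍ}`) [cite: HoshiMochizukiCbTpI2012, Prop 2.9(i) p.44];
S. Mochizuki, *Semi-graphs of anabelioids*, Publ. RIMS **42** (2006), Thm. 3.7 (iii) p. 41, Ex. 3.10 p. 44, §6 p. 71
[cite: MochizukiSemiAnbd2006, Thm 3.7(iii) p.41].

PROOF-ONLY file (abc-iut cell, seat abc-iut-w4-d059 gen 8, row «COR23VI-HATH-PROSIGMA» keyed by abc-iut-L5-lead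
RULINGS #111/#111b; cone row `IUTchI:Cor2.3(vi)`; no definition, no instance, no new `Prop` fact; abc-iut-w4-d070's
`TemperedCoveringsCor23viOfSpecialFibre.lean` (p490241) is consumed BY NAME, never edited or restated).

WHAT WAS OPEN.  abc-iut-w4-d070 isolated the profinite clause of Cor. 2.3 (vi) at the genuine datum
`StableCurveTemperedData.ofSpecialFibre …` as the binder `hhatH` («`ι(J_x)` lies in a `Π̂_𝔾`-conjugate of
`Π̂_ℍ := closure ι(Π^tp_ℍ)` ⇒ the cusp `ξ_x` meets `ℍ`», GAP row G-w4d070-g11-2) and showed it is EXACTLY the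
residual of the node granted the base cusp incidence `hcusp` (G-w4d070-g11-1): a DATUM-LEVEL law, equivalent to the
node's remaining claim.  THIS FILE splits `hhatH` into

* ONE GENERAL statement `hF` about the chart `S.chart` of `π₁^temp(𝔾^c)` and its profinite completion
  `ι : Π^tp_𝔾 ↪ Π̂_𝔾` — **pro-`Σ̂` edge–subgraph incidence**: for an edge `e` of `𝔾^c`, an edge-like subgroup
  `L ∈ edgeLikeSubgroups S.chart e` ([SemiAnbd] Thm. 3.7 (iii)) and a decomposition subgroup
  `Π^tp_ℍ ∈ S.chart.decompSubgroups ℍ` of a connected sub-semi-graph `ℍ` with a vertex, «`ι(L) ⊆ g · Π̂_ℍ · g⁻¹`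
  for some `g ∈ Π̂_𝔾` ⇒ some branch of `e` abuts to a vertex of `ℍ`» — the statement that [IUTchI] p. 49 l. 62–64
  invokes; in print it is [CbTpI] Prop. 2.9 (i) (pass to the generization `𝒢⇝Node(ℍ)`, in which `Π̂_ℍ` becomes
  the verticial subgroup `Π_{v_ℍ}` and the cusps/edges outside `ℍ` keep their edge-like subgroups) followed by
  [NodNon] Lem. 1.7 (`Π_ẽ ⊆ Π_ṽ` only if `ẽ` abuts `ṽ`), read through abc-iut-L3's dictionary
  «`Π̂_ℍ = closure ι(Π^tp_ℍ)`» (`TemperedDecompositionSubgroupsProfinite*`).  It is displayed as a HYPOTHESIS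
  (no `Prop` definition; D-0067 (1)): a FACT-LIST candidate for the human, recorded on `plan/GAP-LEDGER.md`;
* the cusp ↦ open-edge DICTIONARY `hdict` at the datum («`J_x = ρ^tp(I_x)` IS an edge-like subgroup of the open
  edge `e_x` of `𝔾^c`, whose only vertex is `vtx x`», [SemiAnbd] Ex. 3.10 / §6 p. 71) — ORIGIN DATA of the same
  class as G-w4d070-g11-1, and in fact FINER: `hcusp` FOLLOWS from it (`hcusp_of_cuspEdgeDict`, via
  abc-iut-w4-d070's `hcusp_of_edgeLike` = [SemiAnbd] Thm. 3.7 (iii)).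

Headlines: `hcusp_of_cuspEdgeDict`, **`hhatH_of_hatEdgeIncidence_of_cuspEdgeDict`**, and the one-call closers
`cor23vi_ofSpecialFibre_closureH_of_mem_decompSubgroups_of_hatEdgeIncidence` (general connected `ℍ` with a vertex,
every `Π^tp_ℍ ∈ decompSubgroups ℍ`) / `…_of_piData_of_hatEdgeIncidence` (over abc-iut-L3's origin record
`SpecialFibreTower.PiData`, `ℍ := P.H`, print's cusp predicate `x ↦ (P.proj i).vertexMap (P.vtxOfCusp i x) ∈ ℍ`).
So the node's binder set {`hcusp`, `hhatH`} (LAW 2, both datum-level) becomes {`hF` (ONE general pro-`Σ̂` incidence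
statement = [CbTpI] Prop. 2.9 (i) + [NodNon] Lem. 1.7 under the L3 dictionary), `hdict` (origin datum: cusp ↦ open
edge)}.

## BINDER CENSUS TABLE (L5-lead RULINGS #101 (2) format; classes DATA · DATUM-INTERNAL · FACT-CANDIDATE · ORIGIN)

| binder | class | what it is in print |
|---|---|---|
| `X`, `d`, `S`, `Σ`/`Σ̂`, `hsub`, `hne`, `hprime`, `hp`, `H`/`P`, `TpH`, `hTpH`, `hconn`, `hv`, `vtx`, `i` | DATA / DATUM-INTERNAL | as in p490241's table |
| `h36 : S.Gc.Prop36Hypotheses` | DATUM-INTERNAL | names the completion `ι : Π^tp_𝔾 → Π̂_𝔾` |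
| `hF` | FACT-CANDIDATE (general, not datum-specific) | pro-`Σ̂` edge–subgraph incidence: [CbTpI] Prop. 2.9 (i) p. 44 + [NodNon] Lem. 1.7 p. 17, through «`Π̂_ℍ = closure ι(Π^tp_ℍ)`» |
| `hdict` | ORIGIN (datum dictionary) | "the cusps of `X_K` correspond to the open edges of `G^c`", `I_x ↦` the edge-like subgroup ([SemiAnbd] Ex. 3.10, §6 p. 71); refines G-w4d070-g11-1 |

COUNTS: LAW 0 at the datum level; FACT-CANDIDATE 1 (`hF`); ORIGIN 1 (`hdict`, which also yields `hcusp`).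
Model-RELATIVE (the genuine datum `ofSpecialFibre`); typed ≠ discharged for the [IUTchI] claim keys; a hypothesis
displayed by name is NOT a theorem of the tree; nothing here bears on [IUTchIII] Cor. 3.12 or asserts that abc is
proved or refuted.
-/

noncomputable section

namespace Literature.IUT.HodgeTheaters

open _root_.Topology
open scoped Pointwise
open Literature.AnabelianGeometry.SemiGraphs
open Literature.AnabelianGeometry.SemiGraphs.ProfiniteSemiGraph

namespace StableCurveTemperedData

section Rows

variable {p : ℕ} [Fact p.Prime] (X : TemperedCurve p) (d : X.GroupLevelData)
  (S : SpecialFibreData (X.toTemperedArithmeticGroup d)) (h36 : S.Gc.Prop36Hypotheses)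
  (Sigma SigmaHat : Set ℕ) (hsub : Sigma ⊆ SigmaHat) (hne : Sigma.Nonempty)
  (hprime : ∀ q ∈ SigmaHat, q.Prime) (hp : p ∉ Sigma)
  (TpH : Subgroup S.chart.G)

/-! ### 1. The base cusp incidence `hcusp` from the cusp ↦ open-edge dictionary -/

include h36 in
/-- **`hcusp` (G-w4d070-g11-1) FOLLOWS from the cusp ↦ open-edge dictionary**: if `J_x = S.admissible(I_x ∩ Δ)` is an
edge-like subgroup of an edge one of whose branches abuts to `vtx x`, then `J_x` lies in a verticial subgroup at
`vtx x` ([SemiAnbd] Thm. 3.7 (iii) "edge-like ⊆ verticial of each abutting vertex", abc-iut-w4-d070's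
`hcusp_of_edgeLike`). [cite: MochizukiSemiAnbd2006, Thm 3.7(iii) p.41] -/
theorem hcusp_of_cuspEdgeDict (vtx : {x : X.Pt // X.IsCusp x} → S.Gc.graph.Vertex)
    (hdict : ∀ x : {x : X.Pt // X.IsCusp x}, ∃ b : S.Gc.graph.Branch, S.Gc.graph.abuts b = some (vtx x) ∧
      (∀ b' : S.Gc.graph.Branch, S.Gc.graph.edgeOf b' = S.Gc.graph.edgeOf b →
        ∀ w : S.Gc.graph.Vertex, S.Gc.graph.abuts b' = some w → w = vtx x) ∧
      ((X.inertia x.1).subgroupOf (X.toTemperedArithmeticGroup d).delta).map S.admissible.toMonoidHom ∈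
        edgeLikeSubgroups S.chart (S.Gc.graph.edgeOf b)) :
    ∀ x : {x : X.Pt // X.IsCusp x}, ∃ K ∈ verticialSubgroups S.chart (vtx x),
      ((X.inertia x.1).subgroupOf (X.toTemperedArithmeticGroup d).delta).map S.admissible.toMonoidHom ≤ K := by
  intro x
  obtain ⟨b, hb, -, hJ⟩ := hdict x
  exact hcusp_of_edgeLike X d S h36 vtx x ⟨b, hb, _, hJ, le_rfl⟩

/-! ### 2. The profinite LAW `hhatH` from ONE general incidence statement plus the dictionary -/

/-- **`hhatH` (G-w4d070-g11-2) REDUCED.**  Granted the pro-`Σ̂` edge–subgraph incidence `hF` for the sub-semi-graph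
`ℍ` and its decomposition subgroup `Π^tp_ℍ = TpH` («an edge-like subgroup `L` of an edge `e` with
`ι(L) ⊆ g · Π̂_ℍ · g⁻¹`, `Π̂_ℍ := closure ι(Π^tp_ℍ)`, forces a branch of `e` to abut to a vertex of `ℍ`» —
[CbTpI] Prop. 2.9 (i) + [NodNon] Lem. 1.7 through abc-iut-L3's dictionary) and the cusp ↦ open-edge dictionary `hdict`
(`J_x` is an edge-like subgroup of the open edge `e_x`, all of whose abutting branches abut to `vtx x`): if `ι(J_x)`
lies in a `Π̂_𝔾`-conjugate of `Π̂_ℍ`, then `vtx x ∈ ℍ` — the cusp `ξ_x` meets an irreducible component contained in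
`ℍ`. [cite: Mochizuki2012, Cor 2.3(vi) pp.48-49] [claim: Mochizuki2012, status: disputed] -/
theorem hhatH_of_hatEdgeIncidence_of_cuspEdgeDict {H : S.Gc.graph.Subgraph}
    (vtx : {x : X.Pt // X.IsCusp x} → S.Gc.graph.Vertex)
    (hF : ∀ (e : S.Gc.graph.Edge), ∀ L ∈ edgeLikeSubgroups S.chart e,
      ∀ g : (TemperedGraphGroupData.exists_completion_of_prop36 S.Gc h36 S.chart).choose,
        L.map (TemperedGraphGroupData.exists_completion_of_prop36 S.Gc h36 S.chart).choose_spec.choose.toMonoidHom ≤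
          MulAut.conj g • (TpH.map (TemperedGraphGroupData.exists_completion_of_prop36 S.Gc h36
            S.chart).choose_spec.choose.toMonoidHom).topologicalClosure →
        ∃ b : S.Gc.graph.Branch, S.Gc.graph.edgeOf b = e ∧ ∃ w ∈ H.verts, S.Gc.graph.abuts b = some w)
    (hdict : ∀ x : {x : X.Pt // X.IsCusp x}, ∃ b : S.Gc.graph.Branch, S.Gc.graph.abuts b = some (vtx x) ∧
      (∀ b' : S.Gc.graph.Branch, S.Gc.graph.edgeOf b' = S.Gc.graph.edgeOf b →
        ∀ w : S.Gc.graph.Vertex, S.Gc.graph.abuts b' = some w → w = vtx x) ∧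
      ((X.inertia x.1).subgroupOf (X.toTemperedArithmeticGroup d).delta).map S.admissible.toMonoidHom ∈
        edgeLikeSubgroups S.chart (S.Gc.graph.edgeOf b)) :
    ∀ x : {x : X.Pt // X.IsCusp x},
      (∃ g : (TemperedGraphGroupData.exists_completion_of_prop36 S.Gc h36 S.chart).choose,
        (((X.inertia x.1).subgroupOf (X.toTemperedArithmeticGroup d).delta).map S.admissible.toMonoidHom).map
            (TemperedGraphGroupData.exists_completion_of_prop36 S.Gc h36 S.chart).choose_spec.choose.toMonoidHom ≤
          MulAut.conj g • (TpH.map (TemperedGraphGroupData.exists_completion_of_prop36 S.Gc h36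
            S.chart).choose_spec.choose.toMonoidHom).topologicalClosure) →
      vtx x ∈ H.verts := by
  intro x hx
  obtain ⟨g, hg⟩ := hx
  obtain ⟨b, hb, hcusp_edge, hJ⟩ := hdict x
  obtain ⟨b', hb'e, w, hwH, hb'w⟩ := hF (S.Gc.graph.edgeOf b) _ hJ g hg
  rw [← hcusp_edge b' hb'e w hb'w]
  exact hwH

/-! ### 3. One-call closers: Cor. 2.3 (vi) at the genuine datum from `hF` + the dictionary -/

/-- **Row `IUTchI:Cor2.3(vi)` at the genuine datum for EVERY `Π^tp_ℍ := TpH ∈ decompSubgroups S.chart ℍ`, GENERAL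
connected `ℍ` with a vertex, print's `Π̂_ℍ` and print's cusp predicate `x ↦ vtx x ∈ ℍ` — binders
{`hF` (pro-`Σ̂` edge–subgraph incidence, general), `hdict` (cusp ↦ open edge, origin datum)}**: abc-iut-w4-d070's
closer `cor23vi_ofSpecialFibre_closureH_of_mem_decompSubgroups_of_cuspLaws` with `hcusp := hcusp_of_cuspEdgeDict`
and `hhatH := hhatH_of_hatEdgeIncidence_of_cuspEdgeDict`.  FQ type per the gate rule.
[cite: Mochizuki2012, Cor 2.3(vi) pp.48-49] [claim: Mochizuki2012, status: disputed] -/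
theorem cor23vi_ofSpecialFibre_closureH_of_mem_decompSubgroups_of_hatEdgeIncidence {H : S.Gc.graph.Subgraph}
    (hTpH : TpH ∈ S.chart.decompSubgroups H) (hconn : (S.Gc.restrict H).IsConnected)
    (hv : (S.Gc.restrict H).HasVertex)
    (vtx : {x : X.Pt // X.IsCusp x} → S.Gc.graph.Vertex)
    (hF : ∀ (e : S.Gc.graph.Edge), ∀ L ∈ edgeLikeSubgroups S.chart e,
      ∀ g : (TemperedGraphGroupData.exists_completion_of_prop36 S.Gc h36 S.chart).choose,
        L.map (TemperedGraphGroupData.exists_completion_of_prop36 S.Gc h36 S.chart).choose_spec.choose.toMonoidHom ≤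
          MulAut.conj g • (TpH.map (TemperedGraphGroupData.exists_completion_of_prop36 S.Gc h36
            S.chart).choose_spec.choose.toMonoidHom).topologicalClosure →
        ∃ b : S.Gc.graph.Branch, S.Gc.graph.edgeOf b = e ∧ ∃ w ∈ H.verts, S.Gc.graph.abuts b = some w)
    (hdict : ∀ x : {x : X.Pt // X.IsCusp x}, ∃ b : S.Gc.graph.Branch, S.Gc.graph.abuts b = some (vtx x) ∧
      (∀ b' : S.Gc.graph.Branch, S.Gc.graph.edgeOf b' = S.Gc.graph.edgeOf b →
        ∀ w : S.Gc.graph.Vertex, S.Gc.graph.abuts b' = some w → w = vtx x) ∧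
      ((X.inertia x.1).subgroupOf (X.toTemperedArithmeticGroup d).delta).map S.admissible.toMonoidHom ∈
        edgeLikeSubgroups S.chart (S.Gc.graph.edgeOf b)) :
    Literature.IUT.HodgeTheaters.StableCurveTemperedData.Cor23vi
        (ofSpecialFibre X d S h36 Sigma SigmaHat hsub hne hprime hp TpH ((TpH.map
          (TemperedGraphGroupData.exists_completion_of_prop36 S.Gc h36 S.chart).choose_spec.choose.toMonoidHom
          ).topologicalClosure) (Subgroup.le_topologicalClosure _) (fun x => vtx x ∈ H.verts)) :=
  cor23vi_ofSpecialFibre_closureH_of_mem_decompSubgroups_of_cuspLaws X d S h36 Sigma SigmaHat hsub hne hprime hp TpH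
    hTpH hconn hv vtx (hcusp_of_cuspEdgeDict X d S h36 vtx hdict)
    (hhatH_of_hatEdgeIncidence_of_cuspEdgeDict X d S h36 TpH vtx hF hdict)

/-- **The same for ANY `Π^tp_ℍ := TpH` containing a verticial subgroup of each vertex of `ℍ`** (abc-iut-w4-d070's
`cor23vi_ofSpecialFibre_closureH_of_verticialLe_of_cuspLaws`): binders {`hF`, `hdict`}.  FQ type per the gate rule.
[cite: Mochizuki2012, Cor 2.3(vi) pp.48-49] [claim: Mochizuki2012, status: disputed] -/
theorem cor23vi_ofSpecialFibre_closureH_of_verticialLe_of_hatEdgeIncidence {H : S.Gc.graph.Subgraph}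
    (hTpHv : ∀ v ∈ H.verts, ∃ K ∈ verticialSubgroups S.chart v, K ≤ TpH)
    (vtx : {x : X.Pt // X.IsCusp x} → S.Gc.graph.Vertex)
    (hF : ∀ (e : S.Gc.graph.Edge), ∀ L ∈ edgeLikeSubgroups S.chart e,
      ∀ g : (TemperedGraphGroupData.exists_completion_of_prop36 S.Gc h36 S.chart).choose,
        L.map (TemperedGraphGroupData.exists_completion_of_prop36 S.Gc h36 S.chart).choose_spec.choose.toMonoidHom ≤
          MulAut.conj g • (TpH.map (TemperedGraphGroupData.exists_completion_of_prop36 S.Gc h36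
            S.chart).choose_spec.choose.toMonoidHom).topologicalClosure →
        ∃ b : S.Gc.graph.Branch, S.Gc.graph.edgeOf b = e ∧ ∃ w ∈ H.verts, S.Gc.graph.abuts b = some w)
    (hdict : ∀ x : {x : X.Pt // X.IsCusp x}, ∃ b : S.Gc.graph.Branch, S.Gc.graph.abuts b = some (vtx x) ∧
      (∀ b' : S.Gc.graph.Branch, S.Gc.graph.edgeOf b' = S.Gc.graph.edgeOf b →
        ∀ w : S.Gc.graph.Vertex, S.Gc.graph.abuts b' = some w → w = vtx x) ∧
      ((X.inertia x.1).subgroupOf (X.toTemperedArithmeticGroup d).delta).map S.admissible.toMonoidHom ∈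
        edgeLikeSubgroups S.chart (S.Gc.graph.edgeOf b)) :
    Literature.IUT.HodgeTheaters.StableCurveTemperedData.Cor23vi
        (ofSpecialFibre X d S h36 Sigma SigmaHat hsub hne hprime hp TpH ((TpH.map
          (TemperedGraphGroupData.exists_completion_of_prop36 S.Gc h36 S.chart).choose_spec.choose.toMonoidHom
          ).topologicalClosure) (Subgroup.le_topologicalClosure _) (fun x => vtx x ∈ H.verts)) :=
  cor23vi_ofSpecialFibre_closureH_of_verticialLe_of_cuspLaws X d S h36 Sigma SigmaHat hsub hne hprime hp TpH hTpHv vtx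
    (hcusp_of_cuspEdgeDict X d S h36 vtx hdict) (hhatH_of_hatEdgeIncidence_of_cuspEdgeDict X d S h36 TpH vtx hF hdict)

end Rows

/-! ### 4. Over abc-iut-L3's origin record `SpecialFibreTower.PiData` -/

section PiData

variable {p : ℕ} [Fact p.Prime] (X : TemperedCurve p) (d : X.GroupLevelData)
  (S : SpecialFibreData (X.toTemperedArithmeticGroup d)) (h36 : S.Gc.Prop36Hypotheses)
  (Sigma SigmaHat : Set ℕ) (hsub : Sigma ⊆ SigmaHat) (hne : Sigma.Nonempty)
  (hprime : ∀ q ∈ SigmaHat, q.Prime) (hp : p ∉ Sigma)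
  (TpH : Subgroup S.chart.G)
  {T : SpecialFibreTower X.DeltaTemp} (P : SpecialFibreTower.PiData X d S T)

/-- **Row `IUTchI:Cor2.3(vi)` over the origin record `P`** (`ℍ := P.H`, print's `Π^tp_ℍ := TpH ∈ decompSubgroups
S.chart P.H`, print's `Π̂_ℍ`, print's cusp predicate `x ↦ (P.proj i).vertexMap (P.vtxOfCusp i x) ∈ P.H`, any level
`i`) — binders {`hF` (pro-`Σ̂` edge–subgraph incidence at `ℍ`, general in the edge), `hdict` (cusp ↦ open edge of
`𝔾^c` abutting to the vertex met by the cusp)}.  FQ type per the gate rule.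
[cite: Mochizuki2012, Cor 2.3(vi) pp.48-49] [claim: Mochizuki2012, status: disputed] -/
theorem cor23vi_ofSpecialFibre_closureH_of_piData_of_hatEdgeIncidence (i : ℕ)
    (hTpH : TpH ∈ S.chart.decompSubgroups P.H)
    (hF : ∀ (e : S.Gc.graph.Edge), ∀ L ∈ edgeLikeSubgroups S.chart e,
      ∀ g : (TemperedGraphGroupData.exists_completion_of_prop36 S.Gc h36 S.chart).choose,
        L.map (TemperedGraphGroupData.exists_completion_of_prop36 S.Gc h36 S.chart).choose_spec.choose.toMonoidHom ≤
          MulAut.conj g • (TpH.map (TemperedGraphGroupData.exists_completion_of_prop36 S.Gc h36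
            S.chart).choose_spec.choose.toMonoidHom).topologicalClosure →
        ∃ b : S.Gc.graph.Branch, S.Gc.graph.edgeOf b = e ∧ ∃ w ∈ P.H.verts, S.Gc.graph.abuts b = some w)
    (hdict : ∀ x : {x : X.Pt // X.IsCusp x}, ∃ b : S.Gc.graph.Branch,
      S.Gc.graph.abuts b = some ((P.proj i).vertexMap (P.vtxOfCusp i x)) ∧
      (∀ b' : S.Gc.graph.Branch, S.Gc.graph.edgeOf b' = S.Gc.graph.edgeOf b →
        ∀ w : S.Gc.graph.Vertex, S.Gc.graph.abuts b' = some w → w = (P.proj i).vertexMap (P.vtxOfCusp i x)) ∧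
      ((X.inertia x.1).subgroupOf (X.toTemperedArithmeticGroup d).delta).map S.admissible.toMonoidHom ∈
        edgeLikeSubgroups S.chart (S.Gc.graph.edgeOf b)) :
    Literature.IUT.HodgeTheaters.StableCurveTemperedData.Cor23vi
        (ofSpecialFibre X d S h36 Sigma SigmaHat hsub hne hprime hp TpH ((TpH.map
          (TemperedGraphGroupData.exists_completion_of_prop36 S.Gc h36 S.chart).choose_spec.choose.toMonoidHom
          ).topologicalClosure) (Subgroup.le_topologicalClosure _)
          (fun x => (P.proj i).vertexMap (P.vtxOfCusp i x) ∈ P.H.verts)) :=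
  cor23vi_ofSpecialFibre_closureH_of_mem_decompSubgroups_of_hatEdgeIncidence X d S h36 Sigma SigmaHat hsub hne hprime
    hp TpH hTpH P.H_connected ⟨⟨P.baseVertex, P.baseVertex_mem⟩⟩ (fun x => (P.proj i).vertexMap (P.vtxOfCusp i x))
    hF hdict

/-- **Row `IUTchI:Cor2.3(vi)` over the origin record with the RECORD'S `Π^tp_ℍ := P.TpH`** (field `TpH_verticial`; no
chart hypothesis on `ℍ`): binders {`hF` at `P.TpH`, `hdict`}.  FQ type per the gate rule.
[cite: Mochizuki2012, Cor 2.3(vi) pp.48-49] [claim: Mochizuki2012, status: disputed] -/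
theorem cor23vi_ofSpecialFibre_closureH_piDataTpH_of_hatEdgeIncidence (i : ℕ)
    (hF : ∀ (e : S.Gc.graph.Edge), ∀ L ∈ edgeLikeSubgroups S.chart e,
      ∀ g : (TemperedGraphGroupData.exists_completion_of_prop36 S.Gc h36 S.chart).choose,
        L.map (TemperedGraphGroupData.exists_completion_of_prop36 S.Gc h36 S.chart).choose_spec.choose.toMonoidHom ≤
          MulAut.conj g • (P.TpH.map (TemperedGraphGroupData.exists_completion_of_prop36 S.Gc h36
            S.chart).choose_spec.choose.toMonoidHom).topologicalClosure →
        ∃ b : S.Gc.graph.Branch, S.Gc.graph.edgeOf b = e ∧ ∃ w ∈ P.H.verts, S.Gc.graph.abuts b = some w)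
    (hdict : ∀ x : {x : X.Pt // X.IsCusp x}, ∃ b : S.Gc.graph.Branch,
      S.Gc.graph.abuts b = some ((P.proj i).vertexMap (P.vtxOfCusp i x)) ∧
      (∀ b' : S.Gc.graph.Branch, S.Gc.graph.edgeOf b' = S.Gc.graph.edgeOf b →
        ∀ w : S.Gc.graph.Vertex, S.Gc.graph.abuts b' = some w → w = (P.proj i).vertexMap (P.vtxOfCusp i x)) ∧
      ((X.inertia x.1).subgroupOf (X.toTemperedArithmeticGroup d).delta).map S.admissible.toMonoidHom ∈
        edgeLikeSubgroups S.chart (S.Gc.graph.edgeOf b)) :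
    Literature.IUT.HodgeTheaters.StableCurveTemperedData.Cor23vi
        (ofSpecialFibre X d S h36 Sigma SigmaHat hsub hne hprime hp P.TpH ((P.TpH.map
          (TemperedGraphGroupData.exists_completion_of_prop36 S.Gc h36 S.chart).choose_spec.choose.toMonoidHom
          ).topologicalClosure) (Subgroup.le_topologicalClosure _)
          (fun x => (P.proj i).vertexMap (P.vtxOfCusp i x) ∈ P.H.verts)) :=
  cor23vi_ofSpecialFibre_closureH_of_verticialLe_of_hatEdgeIncidence X d S h36 Sigma SigmaHat hsub hne hprime hp P.TpH
    P.TpH_verticial (fun x => (P.proj i).vertexMap (P.vtxOfCusp i x)) hF hdict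

end PiData

end StableCurveTemperedData

end Literature.IUT.HodgeTheaters

end
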